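import Summits.HodgeConjecture.HodgeConjecture.Theorems.MarkmanPartnerTransportPicardThreeK3SquaresZeta9ModelAlgebra
import Summits.HodgeConjecture.HodgeConjecture.Theorems.MarkmanPartnerTransportPicardThreeK3SquaresOneCycleDegree
import HarnessLib

/-!
# Route MarkmanPartnerTransport · crux `PicardThreeK3Squares` (stmt-HodgeConjecture-19652) —
# the ζ₉ type at Picard number 10: the annihilating cubic and the generation clause are AUTOMATIC

Cell hodge-nonav, crux #4, INDEX row M-θ₉ (prover seat hodge-nonav-19652-p1 gen 12; `--supports
stmt-HodgeConjecture-19652`, helper). `exists_zeta9Type_hodgeConjectureFor_square` (`…Zeta9Type`) asks the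
user, for a K3 surface `S` of the ζ₉ rational real-multiplication type, to supply an annihilating separable
polynomial `P` with `P(0) ≠ 0` (`IsAnnihilatedOnTranscendentalBy S t P`) and the generation clause
`TranscendentalEndomorphismsGeneratedBy S t`. For a surface of Picard number `10` (the Picard number of the
type, `finrank_ker_thetaC_of_zeta9Model`) BOTH are consequences of the conjugacy `σηt = θ_ℂση` alone:

* `aeval_cubic_map_eq` — `(X³ - 3X + 1)(f) = f³ - 3f + 1` for an endomorphism `f`.
* `thetaC_mul_cubic_eq_zero_of_zeta9Model` — `θ_ℂ ∘ (θ_ℂ³ - 3θ_ℂ + 1) = 0` (the quartic identity of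
  `…Zeta9ModelAlgebra`).
* `cubic_apply_eq_zero_of_orthogonal_ker` — for `v ∈ Λ_ℂ` `k3Form`-orthogonal to `ker θ_ℂ`:
  `(θ_ℂ³ - 3θ_ℂ + 1)v = 0` (the operator is self-adjoint with image in `ker θ_ℂ`; non-degeneracy of `k3Form`).
* **`isAnnihilatedOnTranscendentalBy_cubic_of_zeta9Model`** — for a marked projective K3 surface
  `(S, η, p, x)` with `ρ(S) = 10` and an endomorphism `t` killing `N¹(S)` conjugate by a rational isometry `σ`
  to `θ_ℂ`: `P(t) = 0` on `T(S)` for `P = X³ - 3X + 1` (`ση` maps `N¹(S)_ℂ` ONTO `ker θ_ℂ` by the rank count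
  `10 = 10`, hence `T(S)` into its `k3Form`-orthogonal).
* `cubic_irreducible`, `minpoly_eq_cubic` — `X³ - 3X + 1` is irreducible over `ℚ` (a rational root would be
  an integer root, impossible modulo `2`), so it is the minimal polynomial of each of its roots.
* **`exists_zeta9Type_hodgeConjectureFor_square_of_picard_ten`** — THERE IS a ζ₉ datum `(g, y₀, θ)` such
  that EVERY projective K3 surface `S` with `ρ(S) = 10`, marked by `(η, p, x)`, carrying an endomorphism
  `t` of `H²(S(ℂ); ℂ)` (rational, type-preserving, killing `N¹`, image `⊥ N¹`) conjugate by a rational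
  isometry `σ` of `Λ_ℚ` to `θ_ℂ`, satisfies `HodgeConjectureFor 4 (S ⊗ S)` — NO annihilating polynomial and
  NO generation clause among the hypotheses: the cubic is supplied by the previous theorem, and by the
  one-cycle degree law (`OneCycle.generatedBy_or_hasComplexMultiplication_of_eigenvalue_natDegree`: an
  endomorphism with a cubic `(2,0)`-eigenvalue at `ρ = 10` generates `End_Hdg T(S)` unless `S` has CM,
  since `3·j·m + 10 ≠ 22` for `j ≥ 2`, `m ≥ 3`) either `t` generates — and
  `exists_zeta9Type_hodgeConjectureFor_square` applies — or `S` has complex multiplication — and Buskin's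
  CM corollary applies. CONDITIONAL on {`Buskin2019_hodgeIsometry_algebraic`,
  `VanGeemenSchuett2025_zeta9_cycleOnOpenPeriodSet`, `Huybrechts_K3_marking_exists`,
  `Buskin2019_hodgeConjectureFor_square_of_CM` (itself derived in the tree from the first and third:
  `CMThird.hodgeConjectureFor_square_of_CM_of_buskin`)}; credits nothing; HC is NOT proved here.

No definition, no sorry.

References: van Geemen–Schütt, Forum Math. Sigma 13 (2025) e2, Thm. 1.1 (9), §2.4–2.6, §5.6; van Geemen,
Michigan Math. J. 56 (2008), Lemma 3.2 (the degree law); Zarhin, J. reine angew. Math. 341 (1983), Thm. 1.5.1;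
Buskin, J. reine angew. Math. 755 (2019), Thm. 1.1 and Corollary; Huybrechts, *Lectures on K3 Surfaces*,
Ch. 3 Cor. 3.6 and Thm. 3.7.
-/

set_option linter.dupNamespace false

noncomputable section

namespace Summit.HodgeConjecture.HodgeConjecture.Theorems.MarkmanPartnerTransport.RMTypeOrbit

open CategoryTheory MonoidalCategory Polynomial
open Literature.AlgebraicGeometry Literature.AlgebraicGeometry.Motives Literature.AlgebraicGeometry.HodgeTheory
open Literature.AlgebraicGeometry.Surfaces Literature.LinearAlgebra.QuadraticForm
open Literature.AlgebraicTopology.SingularHomology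
open Summit.HodgeConjecture.HodgeConjecture.Theorems.NikulinTwinTransport
open Summit.HodgeConjecture.HodgeConjecture.Theorems.MarkmanPartnerTransport.IsogenyInvariance
open Summit.HodgeConjecture.HodgeConjecture.Theorems.MarkmanPartnerTransport.RMTypeDescent

/-- `MarkedK3[S, η, p, x]`: VERBATIM the `let MarkedK3 := …` binder of the route declaration
`PicardThreeK3Squares` (as in `…RMTypeDescent`). Local notation only. -/
local notation3 (prettyPrint := false) "MarkedK3[" S ", " η ", " p ", " x "]" =>
  (p ≠ 0 ∧ (IsIntegralClass p ∧
    (∀ q : complexBetti S (2 * 2), IsIntegralClass q → ∃ n : ℤ, q = n • p) ∧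
    (∀ c : complexBetti S (2 * 1), IsIntegralClass c ↔ ∃ v : K3Index → ℤ, η c = fun i => (v i : ℂ)) ∧
    (∀ a b : complexBetti S (2 * 1),
      cupProduct (rfl : 2 * 1 + 2 * 1 = 2 * 2) a b = k3Form (η a) (η b) • p) ∧
    IsOfHodgeType 2 S (2 * 1) 2 0 (LinearEquiv.symm η x) ∧
    (∀ τ : complexBetti S (2 * 1), IsOfHodgeType 2 S (2 * 1) 2 0 τ →
      ∃ t : ℂ, τ = t • LinearEquiv.symm η x)) ∧
    (k3Form x x = 0 ∧ 0 < (k3Form (star x) x).re ∧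
      ∃ u : K3Index → ℤ, k3Form (fun i => (u i : ℂ)) x = 0 ∧ 0 < ∑ i, ∑ j, u i * k3Gram i j * u j))

/-- `Zeta9Model[g, y₀, θ]`: VERBATIM the datum conjuncts of the named fact
`VanGeemenSchuett2025_zeta9_cycleOnOpenPeriodSet` (as in `…Zeta9Type`). Local notation only. -/
local notation3 (prettyPrint := false) "Zeta9Model[" g ", " y₀ ", " θ "]" =>
  ((∀ a b : K3Index → ℂ, k3Form (g a) (g b) = k3Form a b) ∧
    (∀ v : K3Index → ℤ, ∃ w : K3Index → ℤ,
      g (fun i => ((v i : ℤ) : ℂ)) = fun i => ((w i : ℤ) : ℂ)) ∧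
    g ^ 9 = 1 ∧
    Module.finrank ℂ (LinearMap.ker (g ^ 3 - 1)) = 10 ∧
    k3Form y₀ y₀ = 0 ∧ 0 < (k3Form (star y₀) y₀).re ∧
    g y₀ = Complex.exp (2 * Real.pi * Complex.I / 9) • y₀ ∧
    (∀ y : K3Index → ℂ, thetaC θ y =
      (1 / 3 : ℂ) • ((2 : ℂ) • g y + (2 : ℂ) • (g ^ 8) y - (g ^ 2) y - (g ^ 4) y - (g ^ 5) y
        - (g ^ 7) y)))

/-- The cubic `X³ - 3X + 1 ∈ ℚ[X]` (minimal polynomial of `2cos(2π/9)`). Local notation only. -/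
local notation3 (prettyPrint := false) "P₉" => (X ^ 3 - C (3 : ℚ) * X + 1 : ℚ[X])

variable {g : Module.End ℂ (K3Index → ℂ)} {y₀ : K3Index → ℂ} {θ : Matrix K3Index K3Index ℚ}

/-! ### The cubic operator `θ³ - 3θ + 1` -/

/-- `(X³ - 3X + 1)(f) = f³ - 3·f + 1` for an endomorphism `f` of a `ℂ`-vector space. [folklore] -/
theorem aeval_cubic_map_eq {V : Type*} [AddCommGroup V] [Module ℂ V] (f : Module.End ℂ V) :
    Polynomial.aeval f ((P₉).map (algebraMap ℚ ℂ)) = f ^ 3 - (3 : ℂ) • f + 1 := by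
  simp only [Polynomial.map_add, Polynomial.map_sub, Polynomial.map_mul, Polynomial.map_pow,
    Polynomial.map_X, Polynomial.map_C, Polynomial.map_one, map_add, map_sub, map_mul, map_pow,
    Polynomial.aeval_X, Polynomial.aeval_C, map_one, Algebra.algebraMap_eq_smul_one, smul_mul_assoc,
    one_mul]
  rw [Rat.smul_one_eq_cast, Rat.cast_ofNat]

/-- **`θ_ℂ ∘ (θ_ℂ³ - 3θ_ℂ + 1) = 0`** for a ζ₉ datum (the quartic identity `θ⁴ - 3θ² + θ = 0` of
`thetaC_quartic_of_zeta9Model`). [cite: GeemenSchutt2023, §2.4 and §5.6] -/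
theorem thetaC_mul_cubic_eq_zero_of_zeta9Model (hZ : Zeta9Model[g, y₀, θ]) :
    thetaC θ * (thetaC θ ^ 3 - (3 : ℂ) • thetaC θ + 1) = 0 := by
  have h := thetaC_quartic_of_zeta9Model hZ
  rw [mul_add, mul_sub, mul_one, mul_smul_comm, ← pow_succ', ← sq]
  exact h

/-- Powers of a `k3Form`-self-adjoint endomorphism are self-adjoint. [folklore] -/
theorem k3Form_pow_selfAdjoint {f : Module.End ℂ (K3Index → ℂ)}
    (hf : ∀ a b : K3Index → ℂ, k3Form (f a) b = k3Form a (f b)) (n : ℕ) (a b : K3Index → ℂ) :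
    k3Form ((f ^ n) a) b = k3Form a ((f ^ n) b) := by
  induction n generalizing a b with
  | zero => simp
  | succ n ih =>
    calc k3Form ((f ^ (n + 1)) a) b = k3Form ((f ^ n) (f a)) b := by rw [pow_succ, Module.End.mul_apply]
      _ = k3Form (f a) ((f ^ n) b) := ih _ _
      _ = k3Form a (f ((f ^ n) b)) := hf _ _
      _ = k3Form a ((f ^ (n + 1)) b) := by rw [pow_succ', Module.End.mul_apply]

/-- **`(θ_ℂ³ - 3θ_ℂ + 1)v = 0` for every `v` that is `k3Form`-orthogonal to `ker θ_ℂ`** (ζ₉ datum): the cubic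
operator is self-adjoint and, by the quartic identity, has image in `ker θ_ℂ`; so `(θ³ - 3θ + 1)v` pairs to zero
with everything and vanishes by the non-degeneracy of the K3 form. Fact-free.
[cite: GeemenSchutt2023, §2.1 and §2.4] -/
theorem cubic_apply_eq_zero_of_orthogonal_ker (hZ : Zeta9Model[g, y₀, θ]) {v : K3Index → ℂ}
    (hv : ∀ w : K3Index → ℂ, thetaC θ w = 0 → k3Form v w = 0) :
    (thetaC θ ^ 3 - (3 : ℂ) • thetaC θ + 1 : Module.End ℂ (K3Index → ℂ)) v = 0 := by
  have hθsa : ∀ a b : K3Index → ℂ, k3Form (thetaC θ a) b = k3Form a (thetaC θ b) :=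
    selfAdjoint_of_zeta9Model hZ.1 hZ.2.2.1 hZ.2.2.2.2.2.2.2
  set Q : Module.End ℂ (K3Index → ℂ) := thetaC θ ^ 3 - (3 : ℂ) • thetaC θ + 1 with hQ
  have hQsa : ∀ a b : K3Index → ℂ, k3Form (Q a) b = k3Form a (Q b) := by
    intro a b
    simp only [hQ, LinearMap.add_apply, LinearMap.sub_apply, LinearMap.smul_apply, Module.End.one_apply,
      k3Form_add_left, k3Form_sub_left, k3Form_smul_left, k3Form_add_right, k3Form_sub_right',
      k3Form_smul_right, k3Form_pow_selfAdjoint hθsa, hθsa]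
  have hker : ∀ w, thetaC θ (Q w) = 0 := fun w => by
    rw [← Module.End.mul_apply, hQ, thetaC_mul_cubic_eq_zero_of_zeta9Model hZ, LinearMap.zero_apply]
  refine k3FormC_nondegenerate.1 (Q v) fun w => ?_
  rw [k3FormC_apply, hQsa, hv (Q w) (hker w)]

/-! ### The cubic `X³ - 3X + 1` -/

/-- `X³ - 3X + 1` is monic. [folklore] -/
theorem cubic_monic : (P₉).Monic := by
  unfold Polynomial.Monic
  monicity!

/-- `deg (X³ - 3X + 1) = 3`. [folklore] -/
theorem cubic_natDegree : (P₉).natDegree = 3 := by compute_degree!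

/-- `X³ - 3X + 1` has no rational root: a rational root of the monic integer cubic would be an integer `n`
with `n³ - 3n + 1 = 0`, impossible modulo `2`. [folklore] -/
theorem not_isRoot_cubic (q : ℚ) : ¬ (P₉).IsRoot q := by
  intro hq
  have hq3 : q ^ 3 - 3 * q + 1 = 0 := by
    simpa [IsRoot, eval_sub, eval_add, eval_pow, eval_X, eval_C, eval_mul, eval_one] using hq
  have hmon : (X ^ 3 - C (3 : ℤ) * X + 1 : ℤ[X]).Monic := by
    unfold Polynomial.Monic
    monicity!
  have haev : aeval q (X ^ 3 - C (3 : ℤ) * X + 1 : ℤ[X]) = 0 := by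
    rw [map_add, map_sub, map_mul, map_pow, aeval_X, aeval_C, map_one]
    simpa using hq3
  obtain ⟨n, hn⟩ := isInteger_of_is_root_of_monic hmon haev
  have hn3 : (n : ℚ) ^ 3 - 3 * n + 1 = 0 := by
    rw [← hq3, ← hn]
    simp
  have hn3' : n ^ 3 - 3 * n + 1 = 0 := by exact_mod_cast hn3
  have h2 : ((n : ZMod 2)) ^ 3 - 3 * (n : ZMod 2) + 1 = 0 := by
    exact_mod_cast congrArg (Int.cast : ℤ → ZMod 2) hn3'
  exact absurd h2 (by generalize (n : ZMod 2) = z; revert z; decide)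

/-- **`X³ - 3X + 1` is irreducible over `ℚ`** (a cubic without rational roots). [folklore] -/
theorem cubic_irreducible : Irreducible (P₉) := by
  refine (cubic_monic.irreducible_iff_roots_eq_zero_of_degree_le_three
    (by rw [cubic_natDegree]; norm_num) (le_of_eq cubic_natDegree)).mpr ?_
  refine Multiset.eq_zero_of_forall_notMem fun q hq => ?_
  exact not_isRoot_cubic q ((mem_roots cubic_monic.ne_zero).mp hq)

/-- **The minimal polynomial of any complex root of `X³ - 3X + 1` is `X³ - 3X + 1`** (irreducible and monic),
in particular of degree `3`. [folklore] -/
theorem minpoly_eq_cubic {e : ℂ} (he : e ^ 3 - 3 * e + 1 = 0) : minpoly ℚ e = P₉ := by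
  refine (minpoly.eq_of_irreducible_of_monic cubic_irreducible ?_ cubic_monic).symm
  rw [map_add, map_sub, map_mul, map_pow, aeval_X, aeval_C, map_one, map_ofNat]
  exact he

/-! ### The annihilating cubic on a K3 surface of the type, from `ρ = 10` -/

variable {S : SchemeOver ℂ}

/-- **`P(t) = 0` on `T(S)` for `P = X³ - 3X + 1`, for every K3 surface of Picard number `10` whose
endomorphism `t` (killing `N¹(S)`) is conjugate by a rational isometry `σ` of `Λ_ℚ` to the ζ₉ model `θ_ℂ`.**
With `A = σ ∘ η`: `A ∘ t = θ_ℂ ∘ A`, so `A` maps `N¹(S)_ℂ` into `ker θ_ℂ`, ONTO by the rank count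
(`dim ker θ_ℂ = 10 = ρ(S)`, `finrank_ker_thetaC_of_zeta9Model`; `A` injective), hence maps `T(S) = N¹(S)^⊥`
into the `k3Form`-orthogonal of `ker θ_ℂ` (`σ`, `η` isometries), where `θ³ - 3θ + 1` vanishes
(`cubic_apply_eq_zero_of_orthogonal_ker`); pull back along the injective `A`. Fact-free.
[cite: GeemenSchutt2023, §2.1, §2.4 and Thm. 1.1 (9)] -/
theorem isAnnihilatedOnTranscendentalBy_cubic_of_zeta9Model (hZ : Zeta9Model[g, y₀, θ])
    (hρ : Module.finrank ℂ ↥(algebraicClasses S 1) = 10)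
    (η : complexBetti S (2 * 1) ≃ₗ[ℂ] (K3Index → ℂ)) (p : complexBetti S (2 * 2)) (x : K3Index → ℂ)
    (hM : MarkedK3[S, η, p, x])
    (t : complexBetti S (2 * 1) →ₗ[ℂ] complexBetti S (2 * 1))
    (ht_N : ∀ d ∈ algebraicClasses S 1, t d = 0)
    (σ : Module.End ℂ (K3Index → ℂ)) (hσ : ∀ a b, k3Form (σ a) (σ b) = k3Form a b)
    (hconj : ∀ c : complexBetti S (2 * 1), σ (η (t c)) = thetaC θ (σ (η c))) :
    IsAnnihilatedOnTranscendentalBy S t (P₉) := by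
  classical
  obtain ⟨hp0, ⟨-, -, -, hηcup, -, -⟩, -⟩ := hM
  -- the comparison map `A = σ ∘ η`
  set A : complexBetti S (2 * 1) →ₗ[ℂ] (K3Index → ℂ) := σ ∘ₗ η.toLinearMap with hA
  have hAapp : ∀ c, A c = σ (η c) := fun c => rfl
  have hσinj : Function.Injective σ := injective_of_k3Form_isometry σ hσ
  have hAinj : Function.Injective A := fun a b hab => η.injective (hσinj hab)
  -- `A(N¹(S)) = ker θ_ℂ`
  set N := algebraicClasses S 1 with hNdef
  have hle : N.map A ≤ LinearMap.ker (thetaC θ) := by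
    rintro w ⟨d, hd, rfl⟩
    rw [LinearMap.mem_ker, hAapp, ← hconj, ht_N d hd, map_zero, map_zero]
  have heq : N.map A = LinearMap.ker (thetaC θ) := by
    refine Submodule.eq_of_le_of_finrank_eq hle ?_
    rw [finrank_ker_thetaC_of_zeta9Model hZ, ← hρ]
    exact LinearEquiv.finrank_eq (Submodule.equivMapOfInjective A hAinj N).symm
  intro y hy
  -- `A y` is orthogonal to `ker θ_ℂ`
  have horth : ∀ w : K3Index → ℂ, thetaC θ w = 0 → k3Form (A y) w = 0 := by
    intro w hw
    have hw' : w ∈ N.map A := by rw [heq]; exact hw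
    obtain ⟨d, hd, rfl⟩ := hw'
    rw [hAapp, hAapp, hσ]
    have hcup := hy d hd
    rw [hηcup] at hcup
    rcases smul_eq_zero.1 hcup with h | h
    · exact h
    · exact absurd h hp0
  have hQ := cubic_apply_eq_zero_of_orthogonal_ker hZ horth
  -- pull back along `A`
  have hconjQ := conj_aeval_apply η t σ hconj ((P₉).map (algebraMap ℚ ℂ)) y
  rw [aeval_cubic_map_eq (thetaC θ), ← hAapp, ← hAapp y, hQ] at hconjQ
  exact hAinj (by rw [map_zero]; exact hconjQ)

/-! ### HC⁴(S ⊗ S) at Picard number 10, no annihilation/generation hypotheses -/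

/-- **HC⁴(S ⊗ S) for every K3 surface of Picard number `10` of the ζ₉ real-multiplication type — with NO
annihilating polynomial and NO generation clause among the hypotheses.** THERE IS a ζ₉ datum `(g, y₀, θ)`
(as supplied by `VanGeemenSchuett2025_zeta9_cycleOnOpenPeriodSet`) such that every projective K3 surface
`S` with `ρ(S) = 10`, marked by `(η, p, x)`, carrying an endomorphism `t` of `H²(S(ℂ); ℂ)` — rational,
Hodge-type preserving, killing `N¹H²`, with image cup-orthogonal to `N¹H²` — which is conjugate to `θ_ℂ` by
a RATIONAL ISOMETRY `σ` of `Λ_ℚ` (`σ(η(t c)) = θ_ℂ(σ(η c))`) satisfies `HodgeConjectureFor 4 (S ⊗ S)`.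
Proof: `P = X³ - 3X + 1` annihilates `t` on `T(S)` (`isAnnihilatedOnTranscendentalBy_cubic_of_zeta9Model`),
so the `(2,0)`-eigenvalue of `t` is a root of the irreducible cubic and has minimal polynomial of degree
`3`; by the one-cycle degree law at `ρ = 10` (`3jm + 10 ≠ 22`) either `t` generates `End_Hdg T(S)` —
then `exists_zeta9Type_hodgeConjectureFor_square` (rational orbit density + Buskin transport + the ζ₉
open-family fact) — or `S` has complex multiplication — then Buskin's CM corollary. CONDITIONAL on
{`Buskin2019_hodgeIsometry_algebraic`, `VanGeemenSchuett2025_zeta9_cycleOnOpenPeriodSet`,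
`Huybrechts_K3_marking_exists`, `Buskin2019_hodgeConjectureFor_square_of_CM`}; credits nothing; HC is
NOT proved here. [cite: GeemenSchutt2023, Thm. 1.1 (9), §4.8, §5.6, §2.4–2.6]
[cite: Vangeemen2008, Lemma 3.2] [cite: Zarhin1983HodgeGroupsK3, Thm. 1.5.1]
[cite: Buskin2019, Thm. 1.1 and Corollary] [cite: Huybrechts2016K3, Ch. 3 Cor. 3.6 and Thm. 3.7] -/
theorem exists_zeta9Type_hodgeConjectureFor_square_of_picard_ten
    (hB : Buskin2019_hodgeIsometry_algebraic) (hV : VanGeemenSchuett2025_zeta9_cycleOnOpenPeriodSet)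
    (hmark : Huybrechts_K3_marking_exists) (hCM : Buskin2019_hodgeConjectureFor_square_of_CM) :
    ∃ (g : Module.End ℂ (K3Index → ℂ)) (y₀ : K3Index → ℂ) (θ : Matrix K3Index K3Index ℚ),
      Zeta9Model[g, y₀, θ] ∧
      ∀ (S : SchemeOver ℂ) (_hS : IsK3Surface S) (_hρ : Module.finrank ℂ ↥(algebraicClasses S 1) = 10)
        (η : complexBetti S (2 * 1) ≃ₗ[ℂ] (K3Index → ℂ)) (p : complexBetti S (2 * 2)) (x : K3Index → ℂ)
        (_hM : MarkedK3[S, η, p, x])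
        (t : complexBetti S (2 * 1) →ₗ[ℂ] complexBetti S (2 * 1))
        (_ht_rat : ∀ y, IsRationalClass y → IsRationalClass (t y))
        (_ht_typ : ∀ (i j : ℕ) (y : complexBetti S (2 * 1)),
          IsOfHodgeType 2 S (2 * 1) i j y → IsOfHodgeType 2 S (2 * 1) i j (t y))
        (_ht_N : ∀ d ∈ algebraicClasses S 1, t d = 0)
        (_ht_perp : ∀ (y : complexBetti S (2 * 1)), ∀ d ∈ algebraicClasses S 1,
          cupProduct (rfl : 2 * 1 + 2 * 1 = 2 * 2) (t y) d = 0)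
        (σ : Module.End ℂ (K3Index → ℂ)) (_hσ : ∀ a b, k3Form (σ a) (σ b) = k3Form a b)
        (_hσrat : ∀ v : K3Index → ℤ, ∃ w : K3Index → ℚ, σ (fun i => (v i : ℂ)) = fun i => (w i : ℂ))
        (_hconj : ∀ c : complexBetti S (2 * 1), σ (η (t c)) = thetaC θ (σ (η c))),
        HodgeConjectureFor 4 (S ⊗ S) := by
  classical
  obtain ⟨g, y₀, θ, hZ, hsq⟩ := exists_zeta9Type_hodgeConjectureFor_square hB hV
  refine ⟨g, y₀, θ, hZ, ?_⟩
  intro S hS hρ η p x hM t ht_rat ht_typ ht_N ht_perp σ hσ hσrat hconj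
  have hHT : Huybrechts_K3_hodgeTypes_H2 := Huybrechts_K3_hodgeTypes_H2_holds
  -- the annihilating cubic
  have hP : IsAnnihilatedOnTranscendentalBy S t (P₉) :=
    isAnnihilatedOnTranscendentalBy_cubic_of_zeta9Model hZ hρ η p x hM t ht_N σ hσ hconj
  obtain ⟨hp0, ⟨hpint, hpgen, hηint, hηcup, h20, hline⟩, hPer⟩ := hM
  -- the `(2,0)`-class and its eigenvalue
  have hx0 : η.symm x ≠ 0 := fun h0 =>
    ne_zero_of_star_self_re_pos hPer.2.1 (by simpa using congrArg η h0)
  obtain ⟨ev, hev⟩ := hline (t (η.symm x)) (ht_typ 2 0 _ h20)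
  have htransc : ∀ d ∈ algebraicClasses S 1,
      cupProduct (rfl : 2 * 1 + 2 * 1 = 2 * 2) (η.symm x) d = 0 := by
    intro d hd
    obtain ⟨-, -, h3⟩ := hHT S hS (η.symm x) h20 hx0
    have h11 : IsOfHodgeType 2 S (2 * 1) 1 1 d :=
      isOfHodgeType_of_mem_algebraicClasses_of_isSmoothProjective hS.isSmoothProjective 1 hd
    have hds := ((h3 d).1 h11).1
    rw [cupProduct_gradedComm_holds ℂ _ (rfl : 2 * 1 + 2 * 1 = 2 * 2) rfl]
    norm_num
    exact hds
  -- `ev` is a root of the cubic, hence has minimal polynomial of degree `3`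
  have hev3 : ev ^ 3 - 3 * ev + 1 = 0 := by
    have h1 := hP (η.symm x) htransc
    rw [aeval_apply_of_eigen hev, smul_eq_zero] at h1
    have h2 := h1.resolve_right hx0
    rw [Polynomial.eval_map, ← Polynomial.aeval_def, map_add, map_sub, map_mul, map_pow, aeval_X, aeval_C,
      map_one, map_ofNat] at h2
    exact h2
  have hdeg : (minpoly ℚ ev).natDegree = 3 := by rw [minpoly_eq_cubic hev3, cubic_natDegree]
  -- the one-cycle degree law at `ρ = 10`: `t` generates, or `S` has CM
  have hk : ∀ j m : ℕ, 2 ≤ j → 3 ≤ m → 3 * j * m + Module.finrank ℂ ↥(algebraicClasses S 1) ≠ 22 := by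
    intro j m hj hm
    rw [hρ]
    have : 18 ≤ 3 * j * m := by nlinarith
    omega
  rcases OneCycle.generatedBy_or_hasComplexMultiplication_of_eigenvalue_natDegree hmark hS hk t ht_rat ht_typ
      ⟨η.symm x, ev, h20, hx0, hev, hdeg⟩ with hgen | hCMS
  · exact hsq S hS (P₉) cubic_irreducible.separable (by simp) η p x
      ⟨hp0, ⟨hpint, hpgen, hηint, hηcup, h20, hline⟩, hPer⟩ t ht_rat ht_typ ht_N ht_perp hP hgen σ hσ hσrat
      hconj
  · exact hCM S hS hCMS

end Summit.HodgeConjecture.HodgeConjecture.Theorems.MarkmanPartnerTransport.RMTypeOrbit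

end
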